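import Literature.IUT.LogVolume.TorsionPointsFactsSchemaWitness
import HarnessLib

/-!
# [IUTchIV] Prop. 1.8 (i), (v), (vi), (vii) over the interface `Prop18.TorsionSetting`: INSTANCE FORMS

PROOF-ONLY companion (0 `def`, 0 `instance`) of `Literature.IUT.LogVolume.TorsionPointsFacts` (the typed
interface, abc-iut-S2/S3) and `Literature.IUT.LogVolume.TorsionPointsFactsSchemaWitness` (abc-iut-w5-d157: the
three named settings `trivialSetting`, `kernelSetting`, `signSetting` and the CLOSURE REFUTERS `not_forall_p18_i`,
`not_forall_p18_v`, `not_forall_p18_vi`, `not_forall_p18_vii`). Written by the cell `abc-iut` (seat abc-iut-f-070,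
KEY INST59F) for the FACT-LIST rows F-2259 `P18_i`, F-2260 `P18_v`, F-2261 `P18_vi`, F-2262 `P18_vii`, whose
∀-closures are refuted (they are SCHEMAS over a lawless interface) and which are therefore consumable only AT A
NAMED INSTANCE. This file records, for each of the four rows, the instance-form theorem — conclusion head = the
row's declaration — at the library's satisfiability model `trivialSetting` AND at the named setting the row's
refuter spares (`signSetting` for (i), (v), (vi); `kernelSetting` for (vii)), so that the kernel census sees each
schema both REFUTED-as-closure and INHABITED-by-name.

HONEST FRAMING: these are degenerate instances of the lawless interface (one-element groups, vacuous reduction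
predicates); they certify the LOGICAL SHAPE of the rows, not arithmetic. The arithmetic content of Prop. 1.8 is in
the tree's REAL forms for elliptic curves (`WeierstrassCurve.VariableChange.eq_one_of_torsion_fixed` (i),
`WeierstrassCurve.isSemistableAt_of_forall_smul_geomTorsion_eq` (v),
`WeierstrassCurve.exists_legendre_j_eq_of_two_torsion_rational` (vi, first sentence)). No bearing on [IUTchIII]
Cor. 3.12; typed ≠ proved; a FACT row is an assumption label on OUR typed statement.

## References

* [Mochizuki2012] S. Mochizuki, IUT IV, Prop. 1.8 (i), (v), (vi), (vii) pp. 18–19 (kurims Apr-2020 manuscript).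
-/

namespace Literature.IUT.LogVolume

namespace Prop18

namespace TorsionSetting

/-! ## Row F-2259 `P18_i` (Serre's criterion) -/

/-- **F-2259, instance form at the satisfiability model**: Prop. 1.8 (i) as typed holds in `trivialSetting`
(first conjunct of `trivialSetting_p18`). [cite: Mochizuki2012, IUTchIV Prop 1.8 (i) p.18] -/
theorem trivialSetting_p18_i : trivialSetting.P18_i := trivialSetting_p18.1

/-- **F-2259, instance form at the setting spared by the refuter**: in `signSetting` (`Aut_k̄(E_k̄) = 1`) the map
`ρ_l ∘ incl` out of a one-element group is injective, so (i) holds — while it fails at `kernelSetting`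
(`kernelSetting_not_p18_i`). [cite: Mochizuki2012, IUTchIV Prop 1.8 (i) p.18] -/
theorem signSetting_p18_i : signSetting.P18_i :=
  fun _ _ _ _ a b _ => Subsingleton.elim a b

/-! ## Row F-2260 `P18_v` (rational `l`-torsion ⟹ semi-stable reduction) -/

/-- **F-2260, instance form at the satisfiability model**. [cite: Mochizuki2012, IUTchIV Prop 1.8 (v) p.19] -/
theorem trivialSetting_p18_v : trivialSetting.P18_v := trivialSetting_p18.2.2.2.2.1

/-- **F-2260, instance form at the setting spared by the refuter**: in `signSetting` the semi-stable-reduction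
predicate is identically `True`, so (v) holds — while it fails at `kernelSetting` (`kernelSetting_not_p18_v`).
[cite: Mochizuki2012, IUTchIV Prop 1.8 (v) p.19] -/
theorem signSetting_p18_v : signSetting.P18_v :=
  fun _ _ _ _ _ _ => trivial

/-! ## Row F-2261 `P18_vi` (Legendre form; semi-stable reduction after `[k′ : k] ≤ 2`) -/

/-- **F-2261, instance form at the satisfiability model**. [cite: Mochizuki2012, IUTchIV Prop 1.8 (vi) p.19] -/
theorem trivialSetting_p18_vi : trivialSetting.P18_vi := trivialSetting_p18.2.2.2.2.2.1

/-- `Nat.card` of the (one-element) automorphism group `Aut_k̄(E_k̄)` of `signSetting` is `1`.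
[cite: Mochizuki2012, IUTchIV Prop 1.8 pp.18-19] -/
theorem signSetting_card_autBar : Nat.card signSetting.AutBar = 1 := by
  simp

/-- **F-2261, instance form at the setting spared by the refuter**: in `signSetting` the hypothesis
"`Aut_k̄(E_k̄) = {±1}`" (`Nat.card AutBar = 2`) fails (`= 1`), so (vi) holds — while it fails at `kernelSetting`
(`kernelSetting_not_p18_vi`). [cite: Mochizuki2012, IUTchIV Prop 1.8 (vi) p.19] -/
theorem signSetting_p18_vi : signSetting.P18_vi := by
  intro h
  rw [signSetting_card_autBar] at h
  exact absurd h (by norm_num)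

/-! ## Row F-2262 `P18_vii` (good reduction ⟹ unramified; multiplicative ⟹ tame, index `∣ n`) -/

/-- **F-2262, instance form at the satisfiability model**. [cite: BLRNeronModels1990, §7.4 Thm 5, Thm 6] -/
theorem trivialSetting_p18_vii : trivialSetting.P18_vii := trivialSetting_p18.2.2.2.2.2.2

/-- **F-2262, instance form at the setting spared by the refuter**: in `kernelSetting` both reduction predicates
are identically `False`, so both clauses of (vii) hold vacuously — while (vii) fails at `signSetting`
(`signSetting_not_p18_vii`). [cite: BLRNeronModels1990, §7.4 Thm 5, Thm 6] -/
theorem kernelSetting_p18_vii : kernelSetting.P18_vii :=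
  fun _ _ _ _ => ⟨fun h => h.elim, fun h => h.elim⟩

/-! ## Summary: each of the four schemas is refuted as a closure and inhabited by name -/

/-- **Rows F-2259 – F-2262 at once**: each of `P18_i`, `P18_v`, `P18_vi`, `P18_vii` HOLDS at a named setting and
FAILS at another named setting of the same interface — the rows are genuine schemas (neither tautologies nor
contradictions), to be consumed at a named instance only. [cite: Mochizuki2012, IUTchIV Prop 1.8 pp.18-19] -/
theorem p18_i_v_vi_vii_schema :
    (signSetting.P18_i ∧ ¬ kernelSetting.P18_i) ∧ (signSetting.P18_v ∧ ¬ kernelSetting.P18_v) ∧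
      (signSetting.P18_vi ∧ ¬ kernelSetting.P18_vi) ∧ (kernelSetting.P18_vii ∧ ¬ signSetting.P18_vii) :=
  ⟨⟨signSetting_p18_i, kernelSetting_not_p18_i⟩, ⟨signSetting_p18_v, kernelSetting_not_p18_v⟩,
    ⟨signSetting_p18_vi, kernelSetting_not_p18_vi⟩, ⟨kernelSetting_p18_vii, signSetting_not_p18_vii⟩⟩

end TorsionSetting

end Prop18

end Literature.IUT.LogVolume
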